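import Mathlib

/-!
# Tier4/Common/Adelic — the adelic pair `(G = U(W), T × T′)` of the relative trace formula, as named objects

Blind re-derivation cell `pub-hodge-repro`, Tier 4 (README §9–§10), seat t4-typer-2 (gen 0).  Target tree path
`lean/Summits/Ventures/HodgeRepro/Tier4/Common/Adelic.lean`.  Mathlib only.  Asked by t4-plan-1 (L1, S11892: «an
`AdelicPair` vocabulary for L1 (G = U(W), G(k), T, T′ ⊂ G, χ, χ′, C_c^∞(G(𝔸)) as a Type with the two period
functionals and the kernel K_f) so `line1_rtf` can be cut into L1.1–L1.7 as statements over named objects»).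

WHAT IS TYPED.  `AdelicPair GA` over a group `GA` = the adelic points `G(𝔸)` of the definite unitary group `G =
U(W)` of the plane `W = W_0 ⊕ W_1` (a parameter, so that no instance is declared here — typer lint rule): its
rational points `G(k)` as a subgroup, the centre `Z ≤ T ∩ T′` with N2 (`χ = χ′` on `Z`, the field `chi_center`), the two tori `T = U(W_0) × U(W_1)` and
`T′ = g (U(W_2) × U(W_3)) g⁻¹` (the seesaw isometry N1) as subgroups, their characters `χ = χ_0 ⊗ χ_1`, `χ′ = χ_2
⊗ χ_3` (as functions on the adelic tori, trivial on the rational points), the test functions `f ∈ C_c^∞(G(𝔸))` as a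
type, the kernel `K_f(x, y) = Σ_{γ ∈ G(k)} f(x⁻¹ γ y)` as a function of two adelic points, and the two period
functionals `P_χ : F ↦ ∫_{[T]} χ(t) F(t) dt`, `P_{χ′}` on functions of the adelic tori as ℂ-LINEAR functionals
(agreeing with the integral on the integrable functions; the linearity is what passes the finite sums of the
geometric and spectral expansions through the integrals — t4-plan-1 S11924).  Derived: the distribution
`J f := P_χ (t ↦ P_{χ′} (t′ ↦ K_f t t′))` of the relative trace formula, and its factorisation through a
`τ`-term expansion is left to the line (L1.1–L1.7).  Every field is a parameter; nothing here is a theorem about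
the intended objects, and nothing here says anything about the status of the Hodge conjecture for CM abelian
varieties, which is NOT proved (HC_CM is NOT proved by anyone in this repository).
-/

set_option autoImplicit false

noncomputable section

namespace Summit.Ventures.HodgeRepro.Tier4.Common

/-- **The adelic pair of the relative trace formula** over the group `GA = G(𝔸)` of adelic points of `G = U(W)`:
`G(k)`, the tori `T`, `T′`, their characters, the centre with N2, the test functions, the kernel and the two
ℂ-linear period functionals. -/
structure AdelicPair (GA : Type) [Group GA] where
  /-- the rational points `G(k)` (a discrete subgroup) -/
  Gk : Subgroup GA
  /-- the torus `T = U(W_0) × U(W_1)` (adelic points) -/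
  T : Subgroup GA
  /-- the torus `T′ = g (U(W_2) × U(W_3)) g⁻¹` (adelic points; N1) -/
  T' : Subgroup GA
  /-- the character `χ = χ_0 ⊗ χ_1` of `T(𝔸)` -/
  chi : T → ℂ
  /-- the character `χ′ = χ_2 ⊗ χ_3` of `T′(𝔸)` -/
  chi' : T' → ℂ
  /-- `χ` is a character -/
  chi_mul : ∀ s t : T, chi (s * t) = chi s * chi t
  /-- `χ′` is a character -/
  chi'_mul : ∀ s t : T', chi' (s * t) = chi' s * chi' t
  /-- `χ` is trivial on the rational points `T(k) = T ∩ G(k)` -/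
  chi_rational : ∀ t : T, (t : GA) ∈ Gk → chi t = 1
  /-- `χ′` is trivial on the rational points `T′(k)` -/
  chi'_rational : ∀ t : T', (t : GA) ∈ Gk → chi' t = 1
  /-- the test functions `f ∈ C_c^∞(G(𝔸))` -/
  TestFn : Type
  /-- a test function as a function on `G(𝔸)` -/
  eval : TestFn → GA → ℂ
  /-- the kernel `K_f(x, y) = Σ_{γ ∈ G(k)} f(x⁻¹ γ y)` -/
  kernel : TestFn → GA → GA → ℂ
  /-- the centre `Z` of `G` (adelic points), contained in both tori -/
  Z : Subgroup GA
  /-- `Z ≤ T` -/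
  Z_le_T : Z ≤ T
  /-- `Z ≤ T′` -/
  Z_le_T' : Z ≤ T'
  /-- **N2**: the two characters agree on the centre, `χ₀χ₁ = χ₂χ₃` on `Z` -/
  chi_center : ∀ (z : GA) (hz : z ∈ Z), chi ⟨z, Z_le_T hz⟩ = chi' ⟨z, Z_le_T' hz⟩
  /-- the period functional `P_χ : F ↦ ∫_{[T]} χ(t) F(t) dt` on functions of `T(𝔸)`, ℂ-linear (agreeing with the
  integral on the integrable functions, a linear extension elsewhere) -/
  periodT : (T → ℂ) →ₗ[ℂ] ℂ
  /-- the period functional `P_{χ′}` on functions of `T′(𝔸)`, ℂ-linear -/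
  periodT' : (T' → ℂ) →ₗ[ℂ] ℂ

namespace AdelicPair

variable {GA : Type} [Group GA] (D : AdelicPair GA)

/-- The kernel restricted to the two tori, `(t, t′) ↦ K_f(t, t′)`. -/
def kernelTori (f : D.TestFn) (t : D.T) (t' : D.T') : ℂ := D.kernel f (t : GA) (t' : GA)

/-- **The distribution of the relative trace formula**, `J(f) = ∫_{[T]} ∫_{[T′]} K_f(t, t′) χ(t) χ′(t′)⁻¹ dt′ dt`
written with the two period functionals: `J f = P_χ (t ↦ P_{χ′} (t′ ↦ K_f(t, t′)))`. -/
def J (f : D.TestFn) : ℂ := D.periodT fun t => D.periodT' fun t' => D.kernelTori f t t'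

/-- `J` unfolded. -/
theorem J_def (f : D.TestFn) : D.J f = D.periodT fun t => D.periodT' fun t' => D.kernel f t t' := rfl

/-- The two period functionals pass through a finite sum of functions (the shape used by the geometric and the
spectral expansions): `P_χ (t ↦ P_{χ′} (t′ ↦ Σ_i F i t t′)) = Σ_i P_χ (t ↦ P_{χ′} (t′ ↦ F i t t′))`. -/
theorem period_period_sum {ι : Type} (s : Finset ι) (F : ι → D.T → D.T' → ℂ) :
    D.periodT (fun t => D.periodT' fun t' => ∑ i ∈ s, F i t t') =
      ∑ i ∈ s, D.periodT (fun t => D.periodT' fun t' => F i t t') := by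
  have h : (fun t => D.periodT' fun t' => ∑ i ∈ s, F i t t') =
      ∑ i ∈ s, fun t => D.periodT' fun t' => F i t t' := by
    funext t
    rw [Finset.sum_apply]
    have : (fun t' => ∑ i ∈ s, F i t t') = ∑ i ∈ s, fun t' => F i t t' := by
      funext t'
      rw [Finset.sum_apply]
    rw [this, map_sum]
  rw [h, map_sum]

/-- `χ₀χ₁ = χ₂χ₃` on the centre, in the form a line uses on a central element `z` of `T` and of `T′`. -/
theorem chi_eq_chi'_of_mem_center (z : GA) (hz : z ∈ D.Z) :
    D.chi ⟨z, D.Z_le_T hz⟩ = D.chi' ⟨z, D.Z_le_T' hz⟩ :=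
  D.chi_center z hz

/-- The left-invariance of the kernel under the rational points in the first variable, as a named predicate
(`K_f(γx, y) = K_f(x, y)` for `γ ∈ G(k)`): what a line proves from the definition of `K_f`, stated by name. -/
def KernelLeftInvariant : Prop :=
  ∀ (f : D.TestFn) (γ : GA), γ ∈ D.Gk → ∀ x y : GA, D.kernel f (γ * x) y = D.kernel f x y

/-- The right-invariance of the kernel under the rational points in the second variable. -/
def KernelRightInvariant : Prop :=
  ∀ (f : D.TestFn) (γ : GA), γ ∈ D.Gk → ∀ x y : GA, D.kernel f x (y * γ) = D.kernel f x y

/-- The sum defining the kernel, as a named predicate: `K_f(x, y) = Σ_{γ ∈ G(k)} f(x⁻¹ γ y)` with the sum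
finite (`f` compactly supported, `G(k)` discrete) — stated through a finite support `S x y` of rational points. -/
def KernelIsSum (support : D.TestFn → GA → GA → Finset GA) : Prop :=
  ∀ (f : D.TestFn) (x y : GA), (∀ γ ∈ support f x y, γ ∈ D.Gk) ∧
    (∀ γ ∈ D.Gk, γ ∉ support f x y → D.eval f (x⁻¹ * γ * y) = 0) ∧
    D.kernel f x y = ∑ γ ∈ support f x y, D.eval f (x⁻¹ * γ * y)

end AdelicPair

end Summit.Ventures.HodgeRepro.Tier4.Common

end
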